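import Literature.NumberTheory.EllipticCurves.LeadingTerm
import Literature.NumberTheory.EllipticCurves.BSDAverageRankFiveSelmer
import HarnessLib

/-!
# bsd.S27 (Bhargava–Skinner–Zhang, "a majority of elliptic curves satisfy BSD"): the counting
# theorems of the printed proof, proved

Sibling proof file of `Literature.NumberTheory.EllipticCurves.LeadingTerm` for the named fact
`Literature.NumberTheory.EllipticCurves.bhargava_skinner_zhang` (**bsd.S27**:
`HeightDensityGE SatisfiesBSDRankLeOne 0.6648`, i.e. when elliptic curves `E_{A,B}/ℚ` are ordered
by naive height, a lower density `≥ 66.48%` of them have `rank E(ℚ) = ord_{s=1} L(E,s) ∈ {0, 1}`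
and finite `Ш`):

> M. Bhargava, C. Skinner, W. Zhang, *A majority of elliptic curves over `ℚ` satisfy the Birch
> and Swinnerton-Dyer conjecture*, arXiv:1407.1826 (2014), Thms 1–2 with Cor 26 (the constant
> `.664816…`).

## The printed proof (source §§2–3) and the status of its inputs in the tree

The proof of Cor 26 (whence Thms 1, 2) combines nine inputs, none of which is a theorem of the
tree, and two of which are already named facts of the tree (so that, under the fact-decomposition
discipline D-0026, this file introduces **no** new named fact and does not restate them):

* **Thm 5** (from Skinner–Urban and Skinner, rank `0`): `p` odd, `E` good ordinary or
  multiplicative at `p`, `E[p]` irreducible, some `ℓ ∥ N`, `ℓ ≠ p`, with `E[p]` ramified at `ℓ`,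
  `S_p(E) = 0` ⟹ `rank = an.rank = 0`; **Thm 9** (from W. Zhang and Skinner–Zhang, rank `1`):
  `p ≥ 5`, conditions (a)–(e), `#S_p(E) = p` ⟹ `rank = an.rank = 1` — not in the tree;
* **Thm 13** (Bhargava–Shankar, `p ≤ 5`: the average of `#S_p` over any large family is
  `p + 1`) — not in the tree for `p = 5` (for `p = 3` it is the unproved named fact
  `heightAverageOn_card_selmerThree_le_four` of `BSDRankZeroDensity.lean`; for `p = 5` it is the
  hypothesis `h31` of `averageRankLE_of_five_selmer_of_inputs`, `BSDAverageRankFiveSelmer.lean`);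
* **Thm 15** (Dokchitser–Dokchitser: `s_p(E) - t_p(E)` is even iff `w(E) = +1`) — the tree's
  unproved named fact `even_selmerRank_sub_torsionRank_iff` (hypothesis `hDD` below);
* **Thm 16** (from Bhargava–Shankar's `5`-Selmer paper, §5: inside any large family defined
  modulo powers of primes `≡ 1 (mod 4)`, a finite union of large subfamilies of relative density
  `> 55.01%` with equidistributed root number, stable under `E ↦ E₋₁` with `w(E₋₁) = -w(E)`) —
  not in the tree;
* **Lemmas 17–19** (the densities `μ(S₀(5)) = 4·5¹⁰/(5(5¹⁰-1))`, `μ(S₁'(5)) = .7918054…`,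
  `μ(S₁(5)) > .7917957`, resting on the product formula for densities of large families of
  Bhargava–Shankar) and **Lemma 20** (`100%` of curves have `E[p]` irreducible and two primes
  `ℓ ∥ N`, `ℓ ≠ p`, with `E[p]` ramified) — not in the tree;
* **Gross–Zagier–Kolyvagin** ("through the work of Kolyvagin et al.", proof of Thm 2: analytic
  rank `≤ 1` ⟹ `Ш` finite) — the tree's unproved named fact
  `rank_eq_analyticRank_of_analyticRank_le_one` of `LeadingTerm.lean`.

What the source proves from these inputs is a **counting argument** (Thms 21, 23, 25 and the
bookkeeping of Cors 22, 24, 26). This file proves the counting theorems, at a finite height `X`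
and for a general prime `p` (the source takes `p = 5` but writes the proofs for general `p`), in
the vocabulary of `BSDRankZeroDensity.lean` / `BSDAverageRankFiveSelmer.lean` (where the same is
done for Thm 41 of Bhargava–Shankar's ternary paper, `markov_step`, and for §6 of the `5`-Selmer
paper, `sum_mordellWeilRank_le`), granted only Thm 15 (`hDD`):

* per curve (`PerCurve`): `#S_p(E) = p^s` is `1`, `p`, or `≥ p²`
  (`natCard_selmerGroup_le_iff`, `sq_le_natCard_selmerGroup_of_lt`); if `w(E) = -1` then
  `p ≤ #S_p(E)` (`le_natCard_selmerGroup_of_rootNumber_eq_neg_one`, torsion-free form of "odd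
  `p`-Selmer rank and thus at least `p` elements", proof of Thm 21); if moreover `E(ℚ)[p] = 0`
  then `#S_p(E) = p` or `≥ p³` (`natCard_selmerGroup_eq_prime_or_cube_le`, "order `p`, `p³`, or
  more than `p³`", proof of Thm 23); if `w(E) = +1` and `E(ℚ)[p] = 0` then `#S_p(E) = 1` or
  `≥ p²` (`natCard_selmerGroup_eq_one_or_sq_le`, "order `1`, `p²`, or more than `p²`", proof of
  Thm 21); and the resulting pointwise linear inequalities between `#S_p(E)` and the indicators
  of `#S_p(E) ≤ p`, `= 1`, `= p` and of `E(ℚ)[p] ≠ 0` (`sq_le_natCard_add`, …);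
* at a finite height (`Counting`), for a subfamily `U` stable under `E_{A,B} ↦ E₋₁ = E_{A,-B}` on
  which the root number is reversed (so that exactly half of its members of height `< X` have
  `w = +1`, `card_filter_rootNumber_eq_one_eq`), writing `Σ_U` for the sum of `#S_p` over the
  members of `U` of height `< X`, `N_U` for their number and `B_U` for the number of them with
  `E(ℚ)[p] ≠ 0`:
  - **Thm 21** (rank `0`): `(p²-1)·#{E ∈ U : #S_p(E) = 1} ≥ (p²+p)/2 · N_U - Σ_U - (p²-1) B_U`
    (`thm21_count`; with `Σ_U ≤ (p+1+η) N_U` from Thm 13 this is the printed proportion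
    `(p-2)/(2p-2)`, `= 3/8` for `p = 5`, up to `η` and the torsion term);
  - **Thm 23** (rank `1`): `(p³-p)·#{E ∈ U : #S_p(E) = p} ≥ (p³+1)/2 · N_U - Σ_U - (p³-1) B_U`
    (`thm23_count`; printed proportion `(p²-p-1)/(2p²-2p)`, `= 19/40`);
  - **Thm 25, first part** (rank `0` or `1`, any subfamily `S`):
    `(p²-1)·#{E ∈ S : #S_p(E) ≤ p} ≥ p² N_S - Σ_S` (`thm25_count`; printed proportion
    `(p²-p-1)/(p²-1)`, `= 19/24`), and
  - **Thm 25, second part, in the combined form used by Cor 26**: for `U ⊆ S` as above,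
    `(p²-1)·#{E ∈ S : #S_p(E) ≤ p} ≥ p² N_S + (p-1)/2 · N_U - Σ_S - (p²+p-2) B_S`
    (`thm25_count_of_subfamily`). For `U = S` this is the printed `(2p-3)/(2p-2)`, `= 7/8`; for
    `U ⊊ S` it interpolates `7/8` on `U` and `19/24` on `S ∖ U` **using Thm 13 on `S` only** —
    the source applies Thm 13 separately to `F = F' ∩ S₁(5)` and to finite unions `F''_ε` of large
    subfamilies exhausting its complement; the combined inequality makes that approximation step
    unnecessary.

## What remains for `bhargava_skinner_zhang_holds` (recorded for the assembler; not done here)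

With `p = 5`, `S` = (a clopen truncation of) the source's `S₁'(5)` (conditions at `5` only:
`5 ∤ A`; if `5 ∣ Δ` then `5 ∤ ord₅ Δ` and, when `A ≡ 3 (mod 5)`, `Δ/5^k (mod 25) ∉ S_k`, proof of
Lemma 18), `U` = the subfamily of Thm 16 inside it, and `S₀` = the pieces of `S₀(5) ∖ S₁'(5)`:
Thm 13 bounds `Σ_S ≤ 6.0001 N_S` and `Σ_{U₀} ≤ 6.0001 N_{U₀}`; `thm25_count_of_subfamily` and
`thm21_count` then produce `≥ (7/8·κ + 19/24·(1-κ)) N_S + 3/8·κ N_{S₀}` curves with `#S₅ ≤ 5`,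
resp. `= 1`, up to `10⁻⁴ N` and the torsion terms; Lemma 20 (`100%`) and
`μ(S₁'(5)) - μ(S₁(5)) ≤ 10⁻⁵`
discard a further `o(N) + 10⁻⁵ N`; Thms 5 and 9 (with Remarks 7, 11) turn the survivors into
curves with `rank = an.rank ∈ {0, 1}`, and Gross–Zagier–Kolyvagin gives `Ш` finite; Lemmas 17–18
and `κ ≥ .5501` give the constant `(7/8 × .5501 + 19/24 × .4499) × .7918054 - … + .00169 = .664816…
≥ .6648` (Cor 26; note that the `S₀(5) ∖ S₁'(5)` contribution `.00169` is needed, the rest being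
only `.66313`). The discharge is therefore blocked on the two named facts above and on vendoring
Thms 5, 9, 13 (`p = 5`), 16 and Lemmas 17–20.

## References

* [BhargavaSkinnerZhang2014] (= the tree's interim key `arXiv14071826`) M. Bhargava, C. Skinner,
  W. Zhang, arXiv:1407.1826: Thms 1, 2, 5, 9, 13, 15, 16, Lemmas 17–20, Thms 21, 23, 25,
  Cors 22, 24, 26.
* [BhargavaShankar5Selmer2013] M. Bhargava, A. Shankar, arXiv:1312.7859, Thm 31 and §5.
* [DokchitserDokchitserAnnals2010] T. Dokchitser, V. Dokchitser, Ann. of Math. 172 (2010), Thm 1.4.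
* [SilvermanAEC2009] J. H. Silverman, *The Arithmetic of Elliptic Curves*, 2nd ed., Thm X.4.2.
-/

noncomputable section

open scoped Classical
open scoped AddSubgroup
open Filter Topology WeierstrassCurve

namespace Literature.NumberTheory.EllipticCurves

/-! ### Per-curve consequences of `#S_p(E) = p^s` and of the parity theorem -/

section PerCurve

variable (W : WeierstrassCurve ℚ) [W.IsElliptic] (p : ℕ) [Fact p.Prime]

/-- `#S_p(E) ≥ 1` ("every `p`-Selmer group has at least one element (namely, the identity
element)", source, proof of Thm 23; here from `#S_p(E) = p^s`, `exists_natCard_selmerGroup_eq_pow`).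
[cite: BhargavaSkinnerZhang2014, proof of Thm 23] -/
theorem one_le_natCard_selmerGroup : 1 ≤ Nat.card (W.selmerGroup p) := by
  obtain ⟨s, hs⟩ := exists_natCard_selmerGroup_eq_pow W p
  rw [hs]
  exact Nat.one_le_pow _ _ (Fact.out : p.Prime).pos

/-- `#S_p(E) > p` forces `#S_p(E) ≥ p²` (the order is a power of `p`; "it must have order `1`,
`p²`, or more than `p²`", source, proof of Thm 21, without the parity information).
[cite: BhargavaSkinnerZhang2014, proof of Thm 21] -/
theorem sq_le_natCard_selmerGroup_of_lt (h : p < Nat.card (W.selmerGroup p)) :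
    p ^ 2 ≤ Nat.card (W.selmerGroup p) := by
  have hp : p.Prime := Fact.out
  obtain ⟨s, hs⟩ := exists_natCard_selmerGroup_eq_pow W p
  rw [hs] at h ⊢
  refine Nat.pow_le_pow_right hp.pos ?_
  by_contra hs2
  push Not at hs2
  interval_cases s
  · rw [pow_zero] at h
    exact absurd (hp.two_le.trans h.le) (by norm_num)
  · rw [pow_one] at h
    exact lt_irrefl _ h

/-- `#S_p(E) ≤ p` iff `#S_p(E) ∈ {1, p}`, i.e. iff the `p`-Selmer rank is `0` or `1` (the order
is a power of `p`). [cite: BhargavaSkinnerZhang2014, proof of Thm 25] -/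
theorem natCard_selmerGroup_le_iff :
    Nat.card (W.selmerGroup p) ≤ p ↔
      Nat.card (W.selmerGroup p) = 1 ∨ Nat.card (W.selmerGroup p) = p := by
  have hp : p.Prime := Fact.out
  constructor
  · intro h
    obtain ⟨s, hs⟩ := exists_natCard_selmerGroup_eq_pow W p
    rw [hs] at h ⊢
    rcases Nat.lt_or_ge s 2 with hs2 | hs2
    · interval_cases s
      · exact Or.inl (pow_zero p)
      · exact Or.inr (pow_one p)
    · exfalso
      have h2 : p ^ 2 ≤ p ^ s := Nat.pow_le_pow_right hp.pos hs2
      have hpp : p < p ^ 2 := by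
        calc p = p ^ 1 := (pow_one p).symm
          _ < p ^ 2 := Nat.pow_lt_pow_right hp.one_lt (by norm_num)
      omega
  · rintro (h | h)
    · rw [h]; exact hp.one_lt.le
    · rw [h]

/-- Over `ℚ` (instance bridge, cf. `BSDAverageRankFiveSelmer.lean`): `S_p(E) = 0` forces
`E(ℚ)[p] = 0` (`mordellWeilRank_eq_zero_and_torsionBy_eq_bot_of_selmerGroup_eq_bot`, Kummer
sequence and Nakayama). [cite: SilvermanAEC2009, Thm X.4.2(a)] -/
theorem torsionBy_eq_bot_of_natCard_selmerGroup_eq_one (h : Nat.card (W.selmerGroup p) = 1) :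
    W.toAffine.Point[(p : ℤ)] = ⊥ := by
  have hbot : W.selmerGroup p = ⊥ := by
    have := (Nat.card_eq_one_iff_unique.mp h).1
    exact (W.selmerGroup p).eq_bot_of_subsingleton
  have h' := mordellWeilRank_eq_zero_and_torsionBy_eq_bot_of_selmerGroup_eq_bot W p hbot
  convert h'.2

/-- **Odd parity, unconditionally in the torsion** (source, proof of Thm 21: the curves with root
number `-1` "have odd `p`-Selmer rank and thus have at least `p` elements in the `p`-Selmer
group"): granted Thm 15 (`hDD`), if `w(E) = -1` then `p ≤ #S_p(E)`. (If `S_p(E) = 0` then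
`E(ℚ)[p] = 0`, so `s = t = 0` is even and `w(E) = +1`.)
[cite: BhargavaSkinnerZhang2014, Thm 15 and proof of Thm 21] -/
theorem le_natCard_selmerGroup_of_rootNumber_eq_neg_one
    (hDD : even_selmerRank_sub_torsionRank_iff) (hw : W.rootNumber = -1) :
    p ≤ Nat.card (W.selmerGroup p) := by
  have hp : p.Prime := Fact.out
  obtain ⟨s, hs⟩ := exists_natCard_selmerGroup_eq_pow W p
  obtain ⟨t, ht⟩ := exists_natCard_torsionBy_eq_pow_rat W p
  have hpar := hDD W p s t hs ht
  rcases Nat.eq_zero_or_pos s with rfl | hspos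
  · exfalso
    rw [pow_zero] at hs
    have htors := torsionBy_eq_bot_of_natCard_selmerGroup_eq_one W p hs
    have ht0 : t = 0 := by
      rw [htors, Nat.card_unique] at ht
      exact (Nat.pow_right_injective hp.two_le ((pow_zero p).trans ht)).symm
    have hw1 : W.rootNumber = 1 := hpar.mp (by rw [ht0]; simp)
    rw [hw1] at hw
    norm_num at hw
  · rw [hs]
    calc p = p ^ 1 := (pow_one p).symm
      _ ≤ p ^ s := Nat.pow_le_pow_right hp.pos hspos

/-- **Even parity** (source, proof of Thm 21: "if the `p`-Selmer group of an elliptic curve has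
even rank, then it must have order `1`, `p²`, or more than `p²`"), for curves with `w(E) = +1` and
`E(ℚ)[p] = 0` (so that `r_p = s_p` in Thm 15): `#S_p(E) = 1` or `p² ≤ #S_p(E)`.
[cite: BhargavaSkinnerZhang2014, Thm 15 and proof of Thm 21] -/
theorem natCard_selmerGroup_eq_one_or_sq_le (hDD : even_selmerRank_sub_torsionRank_iff)
    (hw : W.rootNumber = 1) (htors : W.toAffine.Point[(p : ℤ)] = ⊥) :
    Nat.card (W.selmerGroup p) = 1 ∨ p ^ 2 ≤ Nat.card (W.selmerGroup p) := by
  have hp : p.Prime := Fact.out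
  obtain ⟨s, hs⟩ := exists_natCard_selmerGroup_eq_pow W p
  have ht : Nat.card (W.toAffine.Point[(p : ℤ)]) = p ^ 0 := by
    rw [htors, pow_zero, Nat.card_unique]
  have heven : Even s := by
    have := (hDD W p s 0 hs ht).mpr hw
    simpa using this
  rw [hs]
  rcases Nat.eq_zero_or_pos s with rfl | hspos
  · exact Or.inl (pow_zero p)
  · right
    obtain ⟨k, rfl⟩ := heven
    exact Nat.pow_le_pow_right hp.pos (by omega)

/-- **Odd parity without torsion** (source, proof of Thm 23: "if the `p`-Selmer group of an
elliptic curve has odd rank, then it must have order `p`, `p³`, or more than `p³`"), for curves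
with `w(E) = -1` and `E(ℚ)[p] = 0`: `#S_p(E) = p` or `p³ ≤ #S_p(E)`.
[cite: BhargavaSkinnerZhang2014, Thm 15 and proof of Thm 23] -/
theorem natCard_selmerGroup_eq_prime_or_cube_le (hDD : even_selmerRank_sub_torsionRank_iff)
    (hw : W.rootNumber = -1)
    (htors : W.toAffine.Point[(p : ℤ)] = ⊥) :
    Nat.card (W.selmerGroup p) = p ∨ p ^ 3 ≤ Nat.card (W.selmerGroup p) := by
  have hp : p.Prime := Fact.out
  obtain ⟨s, hs⟩ := exists_natCard_selmerGroup_eq_pow W p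
  have ht : Nat.card (W.toAffine.Point[(p : ℤ)]) = p ^ 0 := by
    rw [htors, pow_zero, Nat.card_unique]
  have hodd : Odd s := by
    rcases Nat.even_or_odd s with he | ho
    · exfalso
      have hw1 : W.rootNumber = 1 := (hDD W p s 0 hs ht).mp (by simpa using he)
      rw [hw1] at hw
      norm_num at hw
    · exact ho
  rw [hs]
  obtain ⟨k, rfl⟩ := hodd
  rcases Nat.eq_zero_or_pos k with rfl | hk
  · exact Or.inl (by rw [mul_zero, zero_add, pow_one])
  · exact Or.inr (Nat.pow_le_pow_right hp.pos (by omega))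

/-- Pointwise form of the first part of Thm 25 (source: "`x + p²(1 - x) ≤ p + 1`"): for every
curve, `p² ≤ #S_p(E) + (p² - 1)·[#S_p(E) ≤ p]`. [cite: BhargavaSkinnerZhang2014, proof of Thm 25] -/
theorem sq_le_natCard_add :
    (p : ℝ) ^ 2 ≤ (Nat.card (W.selmerGroup p) : ℝ) +
      ((p : ℝ) ^ 2 - 1) * (if Nat.card (W.selmerGroup p) ≤ p then 1 else 0) := by
  by_cases h : Nat.card (W.selmerGroup p) ≤ p
  · rw [if_pos h, mul_one]
    have h1 : (1 : ℝ) ≤ Nat.card (W.selmerGroup p) := by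
      exact_mod_cast one_le_natCard_selmerGroup W p
    linarith
  · rw [if_neg h, mul_zero, add_zero]
    exact_mod_cast sq_le_natCard_selmerGroup_of_lt W p (not_le.mp h)

/-- Pointwise form of the second part of Thm 25 on the root-number-`-1` half (source:
"`x₀ + p²(1/2 - x₀) + p(x₁ + p²(1/2 - x₁)) ≤ p + 1`", torsion-corrected): if `w(E) = -1` then
`p² + p - 1 ≤ #S_p(E) + (p² - 1)·[#S_p(E) ≤ p] + (p² + p - 2)·[E(ℚ)[p] ≠ 0]`. (With
`E(ℚ)[p] = 0`: `#S_p = p` gives equality, otherwise `#S_p ≥ p³ ≥ p² + p - 1`; with `E(ℚ)[p] ≠ 0`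
only `#S_p ≥ 1` is used.) [cite: BhargavaSkinnerZhang2014, proof of Thm 25] -/
theorem sq_add_le_natCard_add_of_rootNumber_eq_neg_one (hDD : even_selmerRank_sub_torsionRank_iff)
    (hw : W.rootNumber = -1) :
    (p : ℝ) ^ 2 + p - 1 ≤ (Nat.card (W.selmerGroup p) : ℝ) +
      ((p : ℝ) ^ 2 - 1) * (if Nat.card (W.selmerGroup p) ≤ p then 1 else 0) +
      ((p : ℝ) ^ 2 + p - 2) * (if W.toAffine.Point[(p : ℤ)] ≠ ⊥ then 1 else 0) := by
  have hp : p.Prime := Fact.out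
  have hp2 : (2 : ℝ) ≤ p := by exact_mod_cast hp.two_le
  have h1 : (1 : ℝ) ≤ Nat.card (W.selmerGroup p) := by
    exact_mod_cast one_le_natCard_selmerGroup W p
  have hc : (0 : ℝ) ≤ ((p : ℝ) ^ 2 - 1) * (if Nat.card (W.selmerGroup p) ≤ p then 1 else 0) :=
    mul_nonneg (by nlinarith) (by split_ifs <;> norm_num)
  by_cases hb : W.toAffine.Point[(p : ℤ)] = ⊥
  · rw [if_neg (not_not_intro hb), mul_zero, add_zero]
    rcases natCard_selmerGroup_eq_prime_or_cube_le W p hDD hw hb with h | h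
    · rw [if_pos h.le, h, mul_one]
      linarith
    · have h3 : (p : ℝ) ^ 3 ≤ Nat.card (W.selmerGroup p) := by exact_mod_cast h
      have hkey : (p : ℝ) ^ 3 - ((p : ℝ) ^ 2 + p - 1) = ((p : ℝ) - 1) ^ 2 * (p + 1) := by ring
      have hpos : (0 : ℝ) ≤ ((p : ℝ) - 1) ^ 2 * (p + 1) := by positivity
      linarith
  · rw [if_pos hb, mul_one]
    linarith

/-- Pointwise form of Thm 21 on the root-number-`+1` half (torsion-corrected): if `w(E) = +1`
then `p² ≤ #S_p(E) + (p² - 1)·[#S_p(E) = 1] + (p² - 1)·[E(ℚ)[p] ≠ 0]`.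
[cite: BhargavaSkinnerZhang2014, proof of Thm 21] -/
theorem sq_le_natCard_add_of_rootNumber_eq_one (hDD : even_selmerRank_sub_torsionRank_iff)
    (hw : W.rootNumber = 1) :
    (p : ℝ) ^ 2 ≤ (Nat.card (W.selmerGroup p) : ℝ) +
      ((p : ℝ) ^ 2 - 1) * (if Nat.card (W.selmerGroup p) = 1 then 1 else 0) +
      ((p : ℝ) ^ 2 - 1) * (if W.toAffine.Point[(p : ℤ)] ≠ ⊥ then 1 else 0) := by
  have hp : p.Prime := Fact.out
  have hp2 : (2 : ℝ) ≤ p := by exact_mod_cast hp.two_le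
  have h1 : (1 : ℝ) ≤ Nat.card (W.selmerGroup p) := by
    exact_mod_cast one_le_natCard_selmerGroup W p
  have hc : (0 : ℝ) ≤ ((p : ℝ) ^ 2 - 1) * (if Nat.card (W.selmerGroup p) = 1 then 1 else 0) :=
    mul_nonneg (by nlinarith) (by split_ifs <;> norm_num)
  by_cases hb : W.toAffine.Point[(p : ℤ)] = ⊥
  · rw [if_neg (not_not_intro hb), mul_zero, add_zero]
    rcases natCard_selmerGroup_eq_one_or_sq_le W p hDD hw hb with h | h
    · rw [if_pos h, h, mul_one]
      push_cast
      linarith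
    · have h2 : (p : ℝ) ^ 2 ≤ Nat.card (W.selmerGroup p) := by exact_mod_cast h
      linarith
  · rw [if_pos hb, mul_one]
    linarith

/-- Pointwise form of Thm 23 on the root-number-`-1` half (torsion-corrected): if `w(E) = -1`
then `p³ ≤ #S_p(E) + (p³ - p)·[#S_p(E) = p] + (p³ - 1)·[E(ℚ)[p] ≠ 0]`.
[cite: BhargavaSkinnerZhang2014, proof of Thm 23] -/
theorem cube_le_natCard_add_of_rootNumber_eq_neg_one (hDD : even_selmerRank_sub_torsionRank_iff)
    (hw : W.rootNumber = -1) :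
    (p : ℝ) ^ 3 ≤ (Nat.card (W.selmerGroup p) : ℝ) +
      ((p : ℝ) ^ 3 - p) * (if Nat.card (W.selmerGroup p) = p then 1 else 0) +
      ((p : ℝ) ^ 3 - 1) * (if W.toAffine.Point[(p : ℤ)] ≠ ⊥ then 1 else 0) := by
  have hp : p.Prime := Fact.out
  have hp2 : (2 : ℝ) ≤ p := by exact_mod_cast hp.two_le
  have h1 : (1 : ℝ) ≤ Nat.card (W.selmerGroup p) := by
    exact_mod_cast one_le_natCard_selmerGroup W p
  have hpp : (0 : ℝ) ≤ (p : ℝ) ^ 3 - p := by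
    have hkey : (p : ℝ) ^ 3 - p = ((p : ℝ) - 1) * p * (p + 1) := by ring
    rw [hkey]
    exact mul_nonneg (mul_nonneg (by linarith) (by linarith)) (by linarith)
  have hc : (0 : ℝ) ≤ ((p : ℝ) ^ 3 - p) * (if Nat.card (W.selmerGroup p) = p then 1 else 0) :=
    mul_nonneg hpp (by split_ifs <;> norm_num)
  by_cases hb : W.toAffine.Point[(p : ℤ)] = ⊥
  · rw [if_neg (not_not_intro hb), mul_zero, add_zero]
    rcases natCard_selmerGroup_eq_prime_or_cube_le W p hDD hw hb with h | h
    · rw [if_pos h, h, mul_one]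
      linarith
    · have h3 : (p : ℝ) ^ 3 ≤ Nat.card (W.selmerGroup p) := by exact_mod_cast h
      linarith
  · rw [if_pos hb, mul_one]
    linarith

end PerCurve

/-! ### The counting theorems (Thms 21, 23, 25) at a finite height -/

section Counting

variable (p : ℕ) [Fact p.Prime]

/-- Members of the height family are elliptic curves (`isElliptic_shortWeierstrass`). [folklore] -/
theorem isElliptic_of_mem_filter {P : ℤ × ℤ → Prop} {X : ℕ} {AB : ℤ × ℤ}
    (h : AB ∈ (heightFamilyBelow X).filter P) : (shortWeierstrass AB).IsElliptic :=
  isElliptic_shortWeierstrass ((mem_heightFamilyBelow_iff AB X).mp (Finset.mem_filter.mp h).1).1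

/-- **Thm 25 of the source, first part, as a count at height `X`** ("`x + p²(1 - x) ≤ p + 1`, and
hence `x ≥ (p² - p - 1)/(p² - 1)`", for any family): for any subfamily `S`,
`p² · N_S - Σ_S ≤ (p² - 1) · #{E ∈ S, H(E) < X : #S_p(E) ≤ p}`, where `N_S` is the number of
members of `S` of naive height `< X` and `Σ_S` the sum of their `#S_p`. With `Σ_S ≤ (p + 1 + η) N_S`
(Thm 13) the proportion of `p`-Selmer rank `≤ 1` is `≥ (p² - p - 1 - η)/(p² - 1)` (`19/24` for
`p = 5`). No parity input is needed here.
[cite: BhargavaSkinnerZhang2014, Thm 25 (first part, proof)] -/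
theorem thm25_count (S : ℤ × ℤ → Prop) (X : ℕ) :
    (p : ℝ) ^ 2 * ((heightFamilyBelow X).filter S).card -
        ∑ AB ∈ (heightFamilyBelow X).filter S,
          (Nat.card ((shortWeierstrass AB).selmerGroup p) : ℝ) ≤
      ((p : ℝ) ^ 2 - 1) * (((heightFamilyBelow X).filter S).filter
          (fun AB ↦ Nat.card ((shortWeierstrass AB).selmerGroup p) ≤ p)).card := by
  set s := (heightFamilyBelow X).filter S
  have key : ∀ AB ∈ s, (p : ℝ) ^ 2 ≤ (Nat.card ((shortWeierstrass AB).selmerGroup p) : ℝ) +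
      ((p : ℝ) ^ 2 - 1) *
        (if Nat.card ((shortWeierstrass AB).selmerGroup p) ≤ p then 1 else 0) := by
    intro AB hAB
    haveI := isElliptic_of_mem_filter hAB
    exact sq_le_natCard_add (shortWeierstrass AB) p
  have hsum := Finset.sum_le_sum key
  rw [Finset.sum_const, nsmul_eq_mul, Finset.sum_add_distrib, ← Finset.mul_sum,
    Finset.sum_boole] at hsum
  linarith

/-- **Thm 25 of the source, second part, combined with the first, as a count at height `X`.**
Let `U ⊆ S` be subfamilies with `U` stable under `E ↦ E₋₁ = E_{A,-B}` and `w(E₋₁) = -w(E)` on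
`U` (so that exactly half of the members of `U` of height `< X` have `w = -1`,
`card_filter_rootNumber_eq_one_eq`), and grant Thm 15 (`hDD`). Then
`p² N_S + (p-1)/2 · N_U - Σ_S - (p² + p - 2) B_S ≤ (p² - 1) · #{E ∈ S, H(E) < X : #S_p(E) ≤ p}`,
where `B_S` counts the members of `S` of height `< X` with `E(ℚ)[p] ≠ 0`. Proof: sum
`sq_le_natCard_add` over the members off the `w = -1` half of `U` and
`sq_add_le_natCard_add_of_rootNumber_eq_neg_one` over that half. For `U = S` and
`Σ_S ≤ (p + 1 + η) N_S` (Thm 13) this is the printed "`x₀ + x₁ ≥ (2p-3)/(2p-2)`" (`7/8` for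
`p = 5`); in general it gives `(2p-3)/(2p-2)` of `U` plus `(p²-p-1)/(p²-1)` of `S ∖ U`, using
Thm 13 on `S` only (the form in which Cor 26 combines the two parts).
[cite: BhargavaSkinnerZhang2014, Thm 25 (proof) and Cor 26 (proof)] -/
theorem thm25_count_of_subfamily (hDD : even_selmerRank_sub_torsionRank_iff)
    (S U : ℤ × ℤ → Prop) (hUS : ∀ AB, U AB → S AB)
    (hU : ∀ AB, U AB → U (negB AB))
    (hflip : ∀ AB, U AB →
      (shortWeierstrass (negB AB)).rootNumber = -(shortWeierstrass AB).rootNumber) (X : ℕ) :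
    (p : ℝ) ^ 2 * ((heightFamilyBelow X).filter S).card +
        ((p : ℝ) - 1) / 2 * ((heightFamilyBelow X).filter U).card -
        ∑ AB ∈ (heightFamilyBelow X).filter S,
          (Nat.card ((shortWeierstrass AB).selmerGroup p) : ℝ) -
        ((p : ℝ) ^ 2 + p - 2) * (((heightFamilyBelow X).filter S).filter
          (fun AB ↦ (shortWeierstrass AB).toAffine.Point[(p : ℤ)] ≠ ⊥)).card ≤
      ((p : ℝ) ^ 2 - 1) * (((heightFamilyBelow X).filter S).filter
          (fun AB ↦ Nat.card ((shortWeierstrass AB).selmerGroup p) ≤ p)).card := by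
  set s := (heightFamilyBelow X).filter S with hs_def
  set t := (heightFamilyBelow X).filter U with ht_def
  -- the `w = -1` half `M` of `U`, seen inside `s`
  have hM : s.filter (fun AB ↦ U AB ∧ ¬ (shortWeierstrass AB).rootNumber = 1) =
      t.filter (fun AB ↦ ¬ (shortWeierstrass AB).rootNumber = 1) := by
    ext AB
    simp only [hs_def, ht_def, Finset.mem_filter]
    constructor
    · rintro ⟨⟨hX, -⟩, hUAB, hw⟩
      exact ⟨⟨hX, hUAB⟩, hw⟩
    · rintro ⟨⟨hX, hUAB⟩, hw⟩
      exact ⟨⟨hX, hUS AB hUAB⟩, hUAB, hw⟩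
  -- `#M = #U / 2`
  have hhalf := card_filter_rootNumber_eq_one_eq U hU hflip X
  have hPM := Finset.card_filter_add_card_filter_not
    (s := t) (fun AB ↦ (shortWeierstrass AB).rootNumber = 1)
  rw [← ht_def] at hhalf
  have hMcard : 2 * ((s.filter (fun AB ↦ U AB ∧ ¬ (shortWeierstrass AB).rootNumber = 1)).card : ℝ)
      = t.card := by
    rw [hM]
    exact_mod_cast (by omega : 2 * (t.filter (fun AB ↦ ¬ (shortWeierstrass AB).rootNumber = 1)).card
      = t.card)
  -- the pointwise inequality
  have hp : p.Prime := Fact.out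
  have hp2 : (2 : ℝ) ≤ p := by exact_mod_cast hp.two_le
  have key : ∀ AB ∈ s, (p : ℝ) ^ 2 +
        ((p : ℝ) - 1) * (if U AB ∧ ¬ (shortWeierstrass AB).rootNumber = 1 then 1 else 0) ≤
      (Nat.card ((shortWeierstrass AB).selmerGroup p) : ℝ) +
        ((p : ℝ) ^ 2 - 1) *
          (if Nat.card ((shortWeierstrass AB).selmerGroup p) ≤ p then 1 else 0) +
        ((p : ℝ) ^ 2 + p - 2) *
          (if (shortWeierstrass AB).toAffine.Point[(p : ℤ)] ≠ ⊥ then 1 else 0) := by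
    intro AB hAB
    haveI := isElliptic_of_mem_filter hAB
    by_cases hmAB : U AB ∧ ¬ (shortWeierstrass AB).rootNumber = 1
    · rw [if_pos hmAB, mul_one]
      have hw : (shortWeierstrass AB).rootNumber = -1 :=
        ((shortWeierstrass AB).rootNumber_eq_one_or).resolve_left hmAB.2
      have := sq_add_le_natCard_add_of_rootNumber_eq_neg_one (shortWeierstrass AB) p hDD hw
      linarith
    · rw [if_neg hmAB, mul_zero, add_zero]
      have h0 := sq_le_natCard_add (shortWeierstrass AB) p
      have hb : (0 : ℝ) ≤ ((p : ℝ) ^ 2 + p - 2) *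
          (if (shortWeierstrass AB).toAffine.Point[(p : ℤ)] ≠ ⊥ then 1 else 0) :=
        mul_nonneg (by nlinarith) (by split_ifs <;> norm_num)
      linarith
  have hsum := Finset.sum_le_sum key
  rw [Finset.sum_add_distrib, Finset.sum_const, nsmul_eq_mul, ← Finset.mul_sum, Finset.sum_boole,
    Finset.sum_add_distrib, Finset.sum_add_distrib, ← Finset.mul_sum, ← Finset.mul_sum,
    Finset.sum_boole, Finset.sum_boole] at hsum
  have hlin : ((p : ℝ) - 1) *
      ((s.filter (fun AB ↦ U AB ∧ ¬ (shortWeierstrass AB).rootNumber = 1)).card : ℝ) =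
      ((p : ℝ) - 1) / 2 * (t.card : ℝ) := by
    rw [← hMcard]
    ring
  linarith

/-- **Thm 21 of the source as a count at height `X`** (rank `0`; "the limsup of the average size
of the `p`-Selmer group among the half of elliptic curves in `F` having even `p`-Selmer rank is at
most `p + 2` … a lower density of at least `(p-2)/(p-1)` of these orders must be equal to `1`",
torsion-corrected). For `U` stable under `E ↦ E₋₁` with `w(E₋₁) = -w(E)` on `U`, granted Thm 15:
`(p² + p)/2 · N_U - Σ_U - (p² - 1) B_U ≤ (p² - 1) · #{E ∈ U, H(E) < X : #S_p(E) = 1}`. With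
`Σ_U ≤ (p + 1 + η) N_U` (Thm 13) the proportion of `U` with trivial `p`-Selmer group is
`≥ (p-2)/(2p-2)` up to `η` and the torsion term (`3/8` for `p = 5`).
[cite: BhargavaSkinnerZhang2014, Thm 21 (proof)] -/
theorem thm21_count (hDD : even_selmerRank_sub_torsionRank_iff) (U : ℤ × ℤ → Prop)
    (hU : ∀ AB, U AB → U (negB AB))
    (hflip : ∀ AB, U AB →
      (shortWeierstrass (negB AB)).rootNumber = -(shortWeierstrass AB).rootNumber) (X : ℕ) :
    ((p : ℝ) ^ 2 + p) / 2 * ((heightFamilyBelow X).filter U).card -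
        ∑ AB ∈ (heightFamilyBelow X).filter U,
          (Nat.card ((shortWeierstrass AB).selmerGroup p) : ℝ) -
        ((p : ℝ) ^ 2 - 1) * (((heightFamilyBelow X).filter U).filter
          (fun AB ↦ (shortWeierstrass AB).toAffine.Point[(p : ℤ)] ≠ ⊥)).card ≤
      ((p : ℝ) ^ 2 - 1) * (((heightFamilyBelow X).filter U).filter
          (fun AB ↦ Nat.card ((shortWeierstrass AB).selmerGroup p) = 1)).card := by
  set t := (heightFamilyBelow X).filter U with ht_def
  have hhalf := card_filter_rootNumber_eq_one_eq U hU hflip X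
  have hPM := Finset.card_filter_add_card_filter_not
    (s := t) (fun AB ↦ (shortWeierstrass AB).rootNumber = 1)
  rw [← ht_def] at hhalf
  have hPcard : 2 * ((t.filter (fun AB ↦ (shortWeierstrass AB).rootNumber = 1)).card : ℝ) =
      t.card := by
    exact_mod_cast (by omega : 2 * (t.filter (fun AB ↦ (shortWeierstrass AB).rootNumber = 1)).card
      = t.card)
  have hp : p.Prime := Fact.out
  have hp2 : (2 : ℝ) ≤ p := by exact_mod_cast hp.two_le
  have hp21 : (0 : ℝ) ≤ (p : ℝ) ^ 2 - 1 := by nlinarith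
  have key : ∀ AB ∈ t, (p : ℝ) + ((p : ℝ) ^ 2 - p) *
        (if (shortWeierstrass AB).rootNumber = 1 then 1 else 0) ≤
      (Nat.card ((shortWeierstrass AB).selmerGroup p) : ℝ) +
        ((p : ℝ) ^ 2 - 1) *
          (if Nat.card ((shortWeierstrass AB).selmerGroup p) = 1 then 1 else 0) +
        ((p : ℝ) ^ 2 - 1) *
          (if (shortWeierstrass AB).toAffine.Point[(p : ℤ)] ≠ ⊥ then 1 else 0) := by
    intro AB hAB
    haveI := isElliptic_of_mem_filter hAB
    by_cases hw : (shortWeierstrass AB).rootNumber = 1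
    · rw [if_pos hw, mul_one]
      have := sq_le_natCard_add_of_rootNumber_eq_one (shortWeierstrass AB) p hDD hw
      linarith
    · rw [if_neg hw, mul_zero, add_zero]
      have hw' : (shortWeierstrass AB).rootNumber = -1 :=
        ((shortWeierstrass AB).rootNumber_eq_one_or).resolve_left hw
      have h0 : (p : ℝ) ≤ Nat.card ((shortWeierstrass AB).selmerGroup p) := by
        exact_mod_cast
          le_natCard_selmerGroup_of_rootNumber_eq_neg_one (shortWeierstrass AB) p hDD hw'
      have h1 : (0 : ℝ) ≤ ((p : ℝ) ^ 2 - 1) *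
          (if Nat.card ((shortWeierstrass AB).selmerGroup p) = 1 then 1 else 0) :=
        mul_nonneg hp21 (by split_ifs <;> norm_num)
      have h2 : (0 : ℝ) ≤ ((p : ℝ) ^ 2 - 1) *
          (if (shortWeierstrass AB).toAffine.Point[(p : ℤ)] ≠ ⊥ then 1 else 0) :=
        mul_nonneg hp21 (by split_ifs <;> norm_num)
      linarith
  have hsum := Finset.sum_le_sum key
  rw [Finset.sum_add_distrib, Finset.sum_const, nsmul_eq_mul, ← Finset.mul_sum, Finset.sum_boole,
    Finset.sum_add_distrib, Finset.sum_add_distrib, ← Finset.mul_sum, ← Finset.mul_sum,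
    Finset.sum_boole, Finset.sum_boole] at hsum
  have hlin : ((p : ℝ) ^ 2 - p) *
      ((t.filter (fun AB ↦ (shortWeierstrass AB).rootNumber = 1)).card : ℝ) =
      ((p : ℝ) ^ 2 - p) / 2 * (t.card : ℝ) := by
    rw [← hPcard]
    ring
  linarith

/-- **Thm 23 of the source as a count at height `X`** (rank `1`; "the limsup of the average order
of the `p`-Selmer groups among the half of elliptic curves in `F` that have odd `p`-Selmer rank is
at most `2p + 1` … a lower density of at least `(p³-2p-1)/(p³-p)` of these orders must be equal to
`p`", torsion-corrected). For `U` stable under `E ↦ E₋₁` with `w(E₋₁) = -w(E)` on `U`, granted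
Thm 15: `(p³ + 1)/2 · N_U - Σ_U - (p³ - 1) B_U ≤ (p³ - p) · #{E ∈ U, H(E) < X : #S_p(E) = p}`.
With `Σ_U ≤ (p + 1 + η) N_U` (Thm 13) the proportion of `U` with `#S_p = p` is
`≥ (p³-2p-1)/(2(p³-p))` up to `η` and the torsion term (`19/40` for `p = 5`).
[cite: BhargavaSkinnerZhang2014, Thm 23 (proof)] -/
theorem thm23_count (hDD : even_selmerRank_sub_torsionRank_iff) (U : ℤ × ℤ → Prop)
    (hU : ∀ AB, U AB → U (negB AB))
    (hflip : ∀ AB, U AB →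
      (shortWeierstrass (negB AB)).rootNumber = -(shortWeierstrass AB).rootNumber) (X : ℕ) :
    ((p : ℝ) ^ 3 + 1) / 2 * ((heightFamilyBelow X).filter U).card -
        ∑ AB ∈ (heightFamilyBelow X).filter U,
          (Nat.card ((shortWeierstrass AB).selmerGroup p) : ℝ) -
        ((p : ℝ) ^ 3 - 1) * (((heightFamilyBelow X).filter U).filter
          (fun AB ↦ (shortWeierstrass AB).toAffine.Point[(p : ℤ)] ≠ ⊥)).card ≤
      ((p : ℝ) ^ 3 - p) * (((heightFamilyBelow X).filter U).filter
          (fun AB ↦ Nat.card ((shortWeierstrass AB).selmerGroup p) = p)).card := by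
  set t := (heightFamilyBelow X).filter U with ht_def
  have hhalf := card_filter_rootNumber_eq_one_eq U hU hflip X
  have hPM := Finset.card_filter_add_card_filter_not
    (s := t) (fun AB ↦ (shortWeierstrass AB).rootNumber = 1)
  rw [← ht_def] at hhalf
  have hMcard : 2 * ((t.filter (fun AB ↦ ¬ (shortWeierstrass AB).rootNumber = 1)).card : ℝ) =
      t.card := by
    exact_mod_cast (by omega : 2 * (t.filter (fun AB ↦ ¬ (shortWeierstrass AB).rootNumber = 1)).card
      = t.card)
  have hp : p.Prime := Fact.out
  have hp2 : (2 : ℝ) ≤ p := by exact_mod_cast hp.two_le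
  have hpp : (0 : ℝ) ≤ (p : ℝ) ^ 3 - p := by
    have hkey : (p : ℝ) ^ 3 - p = ((p : ℝ) - 1) * p * (p + 1) := by ring
    rw [hkey]
    exact mul_nonneg (mul_nonneg (by linarith) (by linarith)) (by linarith)
  have hp31 : (0 : ℝ) ≤ (p : ℝ) ^ 3 - 1 := by linarith
  have key : ∀ AB ∈ t, (1 : ℝ) + ((p : ℝ) ^ 3 - 1) *
        (if ¬ (shortWeierstrass AB).rootNumber = 1 then 1 else 0) ≤
      (Nat.card ((shortWeierstrass AB).selmerGroup p) : ℝ) +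
        ((p : ℝ) ^ 3 - p) *
          (if Nat.card ((shortWeierstrass AB).selmerGroup p) = p then 1 else 0) +
        ((p : ℝ) ^ 3 - 1) *
          (if (shortWeierstrass AB).toAffine.Point[(p : ℤ)] ≠ ⊥ then 1 else 0) := by
    intro AB hAB
    haveI := isElliptic_of_mem_filter hAB
    by_cases hw : (shortWeierstrass AB).rootNumber = 1
    · rw [if_neg (not_not_intro hw), mul_zero, add_zero]
      have h0 : (1 : ℝ) ≤ Nat.card ((shortWeierstrass AB).selmerGroup p) := by
        exact_mod_cast one_le_natCard_selmerGroup (shortWeierstrass AB) p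
      have h1 : (0 : ℝ) ≤ ((p : ℝ) ^ 3 - p) *
          (if Nat.card ((shortWeierstrass AB).selmerGroup p) = p then 1 else 0) :=
        mul_nonneg hpp (by split_ifs <;> norm_num)
      have h2 : (0 : ℝ) ≤ ((p : ℝ) ^ 3 - 1) *
          (if (shortWeierstrass AB).toAffine.Point[(p : ℤ)] ≠ ⊥ then 1 else 0) :=
        mul_nonneg hp31 (by split_ifs <;> norm_num)
      linarith
    · rw [if_pos hw, mul_one]
      have hw' : (shortWeierstrass AB).rootNumber = -1 :=
        ((shortWeierstrass AB).rootNumber_eq_one_or).resolve_left hw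
      have := cube_le_natCard_add_of_rootNumber_eq_neg_one (shortWeierstrass AB) p hDD hw'
      linarith
  have hsum := Finset.sum_le_sum key
  rw [Finset.sum_add_distrib, Finset.sum_const, nsmul_eq_mul, ← Finset.mul_sum, Finset.sum_boole,
    Finset.sum_add_distrib, Finset.sum_add_distrib, ← Finset.mul_sum, ← Finset.mul_sum,
    Finset.sum_boole, Finset.sum_boole] at hsum
  have hlin : ((p : ℝ) ^ 3 - 1) *
      ((t.filter (fun AB ↦ ¬ (shortWeierstrass AB).rootNumber = 1)).card : ℝ) =
      ((p : ℝ) ^ 3 - 1) / 2 * (t.card : ℝ) := by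
    rw [← hMcard]
    ring
  linarith

end Counting

/-! ### The printed constants for `p = 5` (`19/24`, `7/8`, `3/8`, `19/40`) -/

section Five

/-- **Thm 25 for `p = 5`, in proportion form at height `X`.** If the sum of `#S₅` over the members
of `S` of height `< X` is `≤ (6 + η) N_S` (Thm 13 for `p = 5` gives this eventually, for every
`η > 0`, when `S` is a finite union of large families), then for `U ⊆ S` stable under `E ↦ E₋₁`
with reversed root number,
`#{E ∈ S, H(E) < X : #S₅(E) ≤ 5} ≥ (19 - η)/24 · N_S + N_U/12 - 7/6 · B_S`:
the printed `19/24` of `S` (first part of Thm 25) improved to `19/24 + 1/12 = 7/8` on `U` (second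
part), up to `η` and the `5`-torsion term `B_S`.
[cite: BhargavaSkinnerZhang2014, Thm 25 (both parts, p = 5)] -/
theorem thm25_count_five (hDD : even_selmerRank_sub_torsionRank_iff)
    (S U : ℤ × ℤ → Prop) (hUS : ∀ AB, U AB → S AB)
    (hU : ∀ AB, U AB → U (negB AB))
    (hflip : ∀ AB, U AB →
      (shortWeierstrass (negB AB)).rootNumber = -(shortWeierstrass AB).rootNumber) (X : ℕ)
    {η : ℝ} (hsum5 : ∑ AB ∈ (heightFamilyBelow X).filter S,
        (Nat.card ((shortWeierstrass AB).selmerGroup (5 : ℕ)) : ℝ) ≤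
      (6 + η) * ((heightFamilyBelow X).filter S).card) :
    (19 - η) / 24 * ((heightFamilyBelow X).filter S).card +
        (1 / 12) * ((heightFamilyBelow X).filter U).card -
        (7 / 6) * (((heightFamilyBelow X).filter S).filter
          (fun AB ↦ (shortWeierstrass AB).toAffine.Point[((5 : ℕ) : ℤ)] ≠ ⊥)).card ≤
      (((heightFamilyBelow X).filter S).filter
          (fun AB ↦ Nat.card ((shortWeierstrass AB).selmerGroup (5 : ℕ)) ≤ 5)).card := by
  haveI : Fact (Nat.Prime 5) := ⟨by norm_num⟩
  have h := thm25_count_of_subfamily 5 hDD S U hUS hU hflip X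
  have h5 : ((5 : ℕ) : ℝ) = 5 := by norm_num
  rw [h5] at h
  linarith

/-- **Thm 21 for `p = 5`, in proportion form at height `X`** ("at least `3/8` of the curves in `F`
have `5`-Selmer rank `0`"): if the sum of `#S₅` over the members of `U` of height `< X` is
`≤ (6 + η) N_U` (Thm 13), `U` stable under `E ↦ E₋₁` with reversed root number, then
`#{E ∈ U, H(E) < X : #S₅(E) = 1} ≥ (3/8 - η/24) · N_U - B_U`.
[cite: BhargavaSkinnerZhang2014, Thm 21 (p = 5)] -/
theorem thm21_count_five (hDD : even_selmerRank_sub_torsionRank_iff) (U : ℤ × ℤ → Prop)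
    (hU : ∀ AB, U AB → U (negB AB))
    (hflip : ∀ AB, U AB →
      (shortWeierstrass (negB AB)).rootNumber = -(shortWeierstrass AB).rootNumber) (X : ℕ)
    {η : ℝ} (hsum5 : ∑ AB ∈ (heightFamilyBelow X).filter U,
        (Nat.card ((shortWeierstrass AB).selmerGroup (5 : ℕ)) : ℝ) ≤
      (6 + η) * ((heightFamilyBelow X).filter U).card) :
    (3 / 8 - η / 24) * ((heightFamilyBelow X).filter U).card -
        (((heightFamilyBelow X).filter U).filter
          (fun AB ↦ (shortWeierstrass AB).toAffine.Point[((5 : ℕ) : ℤ)] ≠ ⊥)).card ≤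
      (((heightFamilyBelow X).filter U).filter
          (fun AB ↦ Nat.card ((shortWeierstrass AB).selmerGroup (5 : ℕ)) = 1)).card := by
  haveI : Fact (Nat.Prime 5) := ⟨by norm_num⟩
  have h := thm21_count 5 hDD U hU hflip X
  have h5 : ((5 : ℕ) : ℝ) = 5 := by norm_num
  rw [h5] at h
  linarith

/-- **Thm 23 for `p = 5`, in proportion form at height `X`** ("at least `19/40` of the curves in
`F` have `5`-Selmer rank `1`"): if the sum of `#S₅` over the members of `U` of height `< X` is
`≤ (6 + η) N_U` (Thm 13), `U` stable under `E ↦ E₋₁` with reversed root number, then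
`#{E ∈ U, H(E) < X : #S₅(E) = 5} ≥ (19/40 - η/120) · N_U - 31/30 · B_U`.
[cite: BhargavaSkinnerZhang2014, Thm 23 (p = 5)] -/
theorem thm23_count_five (hDD : even_selmerRank_sub_torsionRank_iff) (U : ℤ × ℤ → Prop)
    (hU : ∀ AB, U AB → U (negB AB))
    (hflip : ∀ AB, U AB →
      (shortWeierstrass (negB AB)).rootNumber = -(shortWeierstrass AB).rootNumber) (X : ℕ)
    {η : ℝ} (hsum5 : ∑ AB ∈ (heightFamilyBelow X).filter U,
        (Nat.card ((shortWeierstrass AB).selmerGroup (5 : ℕ)) : ℝ) ≤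
      (6 + η) * ((heightFamilyBelow X).filter U).card) :
    (19 / 40 - η / 120) * ((heightFamilyBelow X).filter U).card -
        (31 / 30) * (((heightFamilyBelow X).filter U).filter
          (fun AB ↦ (shortWeierstrass AB).toAffine.Point[((5 : ℕ) : ℤ)] ≠ ⊥)).card ≤
      (((heightFamilyBelow X).filter U).filter
          (fun AB ↦ Nat.card ((shortWeierstrass AB).selmerGroup (5 : ℕ)) = 5)).card := by
  haveI : Fact (Nat.Prime 5) := ⟨by norm_num⟩
  have h := thm23_count 5 hDD U hU hflip X
  have h5 : ((5 : ℕ) : ℝ) = 5 := by norm_num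
  rw [h5] at h
  linarith

end Five

end Literature.NumberTheory.EllipticCurves

end
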